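import Mathlib
import Literature.Analysis.Calculus.SmoothCutoff
import HarnessLib

/-!
# Crux `OneBodyEntropyBound` (stmt-AtomisticToContinuum-13440), line `registered`: stub `stub_cutoffAndCount`

Route `BECCellInformation`, problem `BoseEinsteinCondensation` of the summit `AtomisticToContinuum`;
support file for the line's skeleton (namespace `…Cruxes.OneBodyEntropyBound.Birth`). Two elementary
geometric tools on `ℝ³ = EuclideanSpace ℝ (Fin 3)` for the lead's one-particle local-energy argument.

**Part (i)** (smooth one-body partition of unity). There is a universal `C₀ > 0` such that for every
coordinate box `Π_j [a_j - m, a_j + s + m]` and every transition width `w > 0` there are `C¹` functions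
`χ, η` with `χ² + η² = 1`, `χ = 1` on the box, `χ = ∇χ = ∇η = 0` off the open box
`Π_j (a_j - m - w, a_j + s + m + w)`, and `‖∇χ‖² + ‖∇η‖² ≤ C₀ / w²`.
*Proof.* One-dimensional profile `θ(t) = cutoff R ((t - c)/w)`, `c = (lo + hi)/2`, `R = 1 + (hi - lo)/(2w)`,
with `cutoff` the tree's smooth plateau of `Literature/Analysis/Calculus/SmoothCutoff.lean` (built from
Mathlib's `Real.smoothTransition`; `= 1` on `[-(R-1), R-1]`, `= 0` with zero derivative off `(-R, R)`,
`[0,1]`-valued, `|cutoff'| ≤ D` uniformly in `R`): `θ` is `C¹`, `= 1` on `[lo, hi]`, `= 0` with zero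
derivative off `(lo - w, hi + w)`, `|θ'| ≤ D/w`. Then `g(x) = θ₀(x₀) θ₁(x₁) θ₂(x₂)`, `‖∇g‖ ≤ 3D/w`
(product rule, `‖proj_j‖ ≤ 1`), and `χ = sin(π g/2)`, `η = cos(π g/2)`:
`‖∇χ‖² + ‖∇η‖² = (π/2)² ‖∇g‖² ≤ (3πD/2)²/w²`.

**Part (ii)** (isolated-point count). In a half-open cube `Q = Π_j [a_j, a_j + s)` at most
`(⌈2s/R⌉₊ + 1)³` points of a finite family can be `R`-isolated (every other point of the family in `Q`
at distance `≥ R`): isolated points are pairwise `≥ R` apart, and the map to the triple of indices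
`⌊(x_j - a_j)/(R/2)⌋₊ < ⌈2s/R⌉₊` is injective on them, since two points with the same triple satisfy
`|x_j - y_j| < R/2` for all `j`, whence `dist < R` (`dist² = Σ_j (x_j - y_j)² ≤ 3R²/4`).

Everything here is `[folklore]`; Mathlib and `Literature.Analysis.Calculus.SmoothCutoff` only.
-/

noncomputable section

namespace Summit.AtomisticToContinuum.BoseEinsteinCondensation.Cruxes.OneBodyEntropyBound.Birth

open Real Set
open Literature.Analysis.Calculus

namespace CutoffCount

/-! ### The one-dimensional profile (from the tree's plateau cutoff `Literature.Analysis.Calculus.cutoff`) -/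

/-- **The one-dimensional profile lemma.** There is `D ≥ 0` such that for all `lo hi w` with `w > 0`
there is a `C¹` function `θ : ℝ → [0, 1]`, `= 1` on `[lo, hi]`, `= 0` with zero derivative off
`(lo - w, hi + w)`, with `|θ'| ≤ D / w`: `θ(t) = cutoff R ((t - c)/w)` with `c = (lo + hi)/2`,
`R = 1 + (hi - lo)/(2w)` and `cutoff` the tree's smooth plateau (`= 1` on `[-(R-1), R-1]`, `= 0` with zero
derivative off `(-R, R)`, `|cutoff'| ≤ D` uniformly in `R`). [folklore] -/
theorem exists_profile : ∃ D : ℝ, 0 ≤ D ∧ ∀ lo hi w : ℝ, 0 < w → ∃ θ : ℝ → ℝ,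
    ContDiff ℝ 1 θ ∧ (∀ t, 0 ≤ θ t ∧ θ t ≤ 1) ∧ (∀ t ∈ Icc lo hi, θ t = 1) ∧
    (∀ t ∉ Ioo (lo - w) (hi + w), θ t = 0 ∧ deriv θ t = 0) ∧ ∀ t, |deriv θ t| ≤ D / w := by
  obtain ⟨D, hD0, hD⟩ := exists_bound_deriv_cutoff
  refine ⟨D, hD0, fun lo hi w hw => ?_⟩
  obtain ⟨c, hc⟩ : ∃ c : ℝ, c = (lo + hi) / 2 := ⟨_, rfl⟩
  obtain ⟨R, hR⟩ : ∃ R : ℝ, R = 1 + (hi - lo) / (2 * w) := ⟨_, rfl⟩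
  have hdiff : Differentiable ℝ (cutoff R) := (contDiff_cutoff R (n := 1)).differentiable (by simp)
  have hθ : ∀ t, HasDerivAt (fun t => cutoff R ((t - c) / w))
      (deriv (cutoff R) ((t - c) / w) * (1 / w)) t := by
    intro t
    have hA : HasDerivAt (fun t : ℝ => (t - c) / w) (1 / w) t := by
      simpa using ((hasDerivAt_id t).sub_const c).div_const w
    exact (hdiff _).hasDerivAt.comp t hA
  have hout : ∀ t ∉ Ioo (lo - w) (hi + w), R ≤ |(t - c) / w| := by
    intro t ht
    rw [mem_Ioo, not_and_or, not_lt, not_lt] at ht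
    rw [abs_div, abs_of_pos hw, le_div_iff₀ hw]
    have hRw : R * w = w + (hi - lo) / 2 := by rw [hR]; field_simp
    rw [hRw]
    rcases ht with ht | ht
    · exact le_trans (by linarith) (neg_le_abs _)
    · exact le_trans (by linarith) (le_abs_self _)
  refine ⟨fun t => cutoff R ((t - c) / w), (contDiff_cutoff R).comp (by fun_prop),
    fun t => ⟨cutoff_nonneg _ _, cutoff_le_one _ _⟩, fun t ht => ?_, fun t ht => ?_, fun t => ?_⟩
  · dsimp only
    apply cutoff_eq_one
    rw [abs_div, abs_of_pos hw, show R - 1 = ((hi - lo) / 2) / w by rw [hR]; ring]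
    exact div_le_div_of_nonneg_right (abs_le.2 ⟨by linarith [ht.1], by linarith [ht.2]⟩) hw.le
  · dsimp only
    refine ⟨cutoff_eq_zero (hout t ht), ?_⟩
    rw [(hθ t).deriv, deriv_cutoff_eq_zero_of_le (hout t ht), zero_mul]
  · rw [(hθ t).deriv, abs_mul, abs_of_pos (by positivity : (0:ℝ) < 1 / w), mul_one_div]
    exact div_le_div_of_nonneg_right (hD R _) hw.le

/-! ### The three-dimensional product and the `sin/cos` partition -/

/-- Product of three coordinate profiles on `ℝ³`: `C¹`, explicit derivative, vanishing (with its
derivative) where one profile vanishes to first order, `‖∇g‖ ≤ 3B`. [folklore] -/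
theorem product_profile (θ : Fin 3 → ℝ → ℝ) (B : ℝ) (hB : 0 ≤ B) (hθc : ∀ j, ContDiff ℝ 1 (θ j))
    (hθ01 : ∀ j t, 0 ≤ θ j t ∧ θ j t ≤ 1) (hθB : ∀ j t, |deriv (θ j) t| ≤ B) :
    ∃ g' : EuclideanSpace ℝ (Fin 3) → (EuclideanSpace ℝ (Fin 3) →L[ℝ] ℝ),
      (ContDiff ℝ 1 fun x : EuclideanSpace ℝ (Fin 3) => θ 0 (x 0) * θ 1 (x 1) * θ 2 (x 2)) ∧
      (∀ x, HasFDerivAt (fun x : EuclideanSpace ℝ (Fin 3) => θ 0 (x 0) * θ 1 (x 1) * θ 2 (x 2))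
        (g' x) x) ∧
      (∀ x : EuclideanSpace ℝ (Fin 3), (∃ j, θ j (x j) = 0 ∧ deriv (θ j) (x j) = 0) →
        θ 0 (x 0) * θ 1 (x 1) * θ 2 (x 2) = 0 ∧ g' x = 0) ∧
      (∀ x, ‖g' x‖ ≤ 3 * B) := by
  set L : Fin 3 → (EuclideanSpace ℝ (Fin 3) →L[ℝ] ℝ) := fun j => EuclideanSpace.proj (𝕜 := ℝ) j
    with hL
  have hLn : ∀ j, ‖L j‖ ≤ 1 := fun j =>
    ContinuousLinearMap.opNorm_le_bound _ zero_le_one fun x => by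
      simpa [hL] using PiLp.norm_apply_le x j
  have hF : ∀ j (x : EuclideanSpace ℝ (Fin 3)),
      HasFDerivAt (fun y : EuclideanSpace ℝ (Fin 3) => θ j (y j)) (deriv (θ j) (x j) • L j) x :=
    fun j x => (((hθc j).differentiable_one) (x j)).hasDerivAt.comp_hasFDerivAt x
      (PiLp.hasFDerivAt_apply (𝕜 := ℝ) 2 x j)
  have hsm : ∀ (c b : ℝ) (v : EuclideanSpace ℝ (Fin 3) →L[ℝ] ℝ), |c| ≤ 1 → ‖v‖ ≤ b → ‖c • v‖ ≤ b :=
    fun c b v hc hv => by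
      rw [norm_smul, Real.norm_eq_abs]
      calc |c| * ‖v‖ ≤ 1 * b := mul_le_mul hc hv (norm_nonneg _) zero_le_one
        _ = b := one_mul b
  refine ⟨fun x => (θ 0 (x 0) * θ 1 (x 1)) • (deriv (θ 2) (x 2) • L 2) +
      θ 2 (x 2) • (θ 0 (x 0) • (deriv (θ 1) (x 1) • L 1) + θ 1 (x 1) • (deriv (θ 0) (x 0) • L 0)),
    ?_, fun x => ?_, fun x hx => ?_, fun x => ?_⟩
  · exact (((hθc 0).comp (L 0).contDiff).mul ((hθc 1).comp (L 1).contDiff)).mul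
      ((hθc 2).comp (L 2).contDiff)
  · exact ((hF 0 x).mul (hF 1 x)).mul (hF 2 x)
  · obtain ⟨j, hj⟩ := hx
    have hj3 : j = 0 ∨ j = 1 ∨ j = 2 := by fin_cases j <;> simp
    rcases hj3 with rfl | rfl | rfl <;> simp [hj.1, hj.2]
  · have hu : ∀ j, |θ j (x j)| ≤ 1 := fun j =>
      abs_le.2 ⟨by linarith [(hθ01 j (x j)).1], (hθ01 j (x j)).2⟩
    have hdL : ∀ j, ‖deriv (θ j) (x j) • L j‖ ≤ B := fun j => by
      rw [norm_smul, Real.norm_eq_abs]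
      calc |deriv (θ j) (x j)| * ‖L j‖ ≤ B * 1 := mul_le_mul (hθB j _) (hLn j) (norm_nonneg _) hB
        _ = B := mul_one B
    have h01 : |θ 0 (x 0) * θ 1 (x 1)| ≤ 1 := by
      rw [abs_mul]; exact mul_le_one₀ (hu 0) (abs_nonneg _) (hu 1)
    calc _ ≤ ‖(θ 0 (x 0) * θ 1 (x 1)) • (deriv (θ 2) (x 2) • L 2)‖ +
          ‖θ 2 (x 2) • (θ 0 (x 0) • (deriv (θ 1) (x 1) • L 1) + θ 1 (x 1) • (deriv (θ 0) (x 0) • L 0))‖ :=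
          norm_add_le _ _
      _ ≤ B + (B + B) :=
          add_le_add (hsm _ _ _ h01 (hdL 2)) (hsm _ _ _ (hu 2) ((norm_add_le _ _).trans
            (add_le_add (hsm _ _ _ (hu 0) (hdL 1)) (hsm _ _ _ (hu 1) (hdL 0)))))
      _ = 3 * B := by ring

/-- The `sin/cos` partition built on a `C¹` function `g` with `‖∇g‖ ≤ B`: `χ = sin(π g/2)`,
`η = cos(π g/2)`, `χ² + η² = 1`, `χ = 1` where `g = 1`, `χ = ∇χ = ∇η = 0` where `g` vanishes to first
order, `‖∇χ‖² + ‖∇η‖² = (π/2)² ‖∇g‖² ≤ (π B/2)²`. [folklore] -/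
theorem partition_of_hasFDerivAt {E : Type*} [NormedAddCommGroup E] [NormedSpace ℝ E]
    (g : E → ℝ) (g' : E → (E →L[ℝ] ℝ)) (B C : ℝ) (inner outer : Set E)
    (hgc : ContDiff ℝ 1 g) (hg : ∀ x, HasFDerivAt g (g' x) x)
    (h_in : ∀ x ∈ inner, g x = 1) (h_out : ∀ x ∈ outer, g x = 0 ∧ g' x = 0)
    (hB : ∀ x, ‖g' x‖ ≤ B) (hC : (π / 2 * B) ^ 2 ≤ C) :
    ∃ χ η : E → ℝ, ContDiff ℝ 1 χ ∧ ContDiff ℝ 1 η ∧ (∀ x, χ x ^ 2 + η x ^ 2 = 1) ∧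
      (∀ x ∈ inner, χ x = 1) ∧ (∀ x ∈ outer, χ x = 0 ∧ fderiv ℝ χ x = 0 ∧ fderiv ℝ η x = 0) ∧
      (∀ x, ‖fderiv ℝ χ x‖ ^ 2 + ‖fderiv ℝ η x‖ ^ 2 ≤ C) := by
  have hχ : ∀ x, HasFDerivAt (fun x => Real.sin (π / 2 * g x))
      (Real.cos (π / 2 * g x) • ((π / 2) • g' x)) x :=
    fun x => (Real.hasDerivAt_sin _).comp_hasFDerivAt x ((hg x).const_mul (π / 2))
  have hη : ∀ x, HasFDerivAt (fun x => Real.cos (π / 2 * g x))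
      (-Real.sin (π / 2 * g x) • ((π / 2) • g' x)) x :=
    fun x => (Real.hasDerivAt_cos _).comp_hasFDerivAt x ((hg x).const_mul (π / 2))
  refine ⟨fun x => Real.sin (π / 2 * g x), fun x => Real.cos (π / 2 * g x), ?_, ?_,
    fun x => Real.sin_sq_add_cos_sq _, fun x hx => ?_, fun x hx => ?_, fun x => ?_⟩
  · exact Real.contDiff_sin.comp (contDiff_const.mul hgc)
  · exact Real.contDiff_cos.comp (contDiff_const.mul hgc)
  · simp [h_in x hx]
  · obtain ⟨h0, h1⟩ := h_out x hx
    refine ⟨by simp [h0], ?_, ?_⟩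
    · rw [(hχ x).fderiv, h1]; simp
    · rw [(hη x).fderiv, h1]; simp
  · rw [(hχ x).fderiv, (hη x).fderiv]
    simp only [norm_smul, norm_neg, Real.norm_eq_abs, abs_of_pos (by positivity : (0:ℝ) < π / 2)]
    have hn := hB x
    calc (|Real.cos (π / 2 * g x)| * (π / 2 * ‖g' x‖)) ^ 2 +
          (|Real.sin (π / 2 * g x)| * (π / 2 * ‖g' x‖)) ^ 2
        = (Real.cos (π / 2 * g x) ^ 2 + Real.sin (π / 2 * g x) ^ 2) * (π / 2 * ‖g' x‖) ^ 2 := by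
          simp only [mul_pow, sq_abs]; ring
      _ = (π / 2 * ‖g' x‖) ^ 2 := by rw [Real.cos_sq_add_sin_sq, one_mul]
      _ ≤ (π / 2 * B) ^ 2 := by gcongr
      _ ≤ C := hC

/-- **Part (i) of the stub**: the `C¹` one-body partition of unity adapted to a coordinate box with
margin `m` and transition width `w`, `‖∇χ‖² + ‖∇η‖² ≤ C₀ / w²` with a universal `C₀`. [folklore] -/
theorem cutoff_exists : ∃ C₀ : ℝ, 0 < C₀ ∧ ∀ (a : Fin 3 → ℝ) (s m w : ℝ), 0 ≤ s → 0 ≤ m → 0 < w →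
      ∃ χ η : EuclideanSpace ℝ (Fin 3) → ℝ,
        ContDiff ℝ 1 χ ∧ ContDiff ℝ 1 η ∧ (∀ x, χ x ^ 2 + η x ^ 2 = 1) ∧
        (∀ x : EuclideanSpace ℝ (Fin 3), (∀ j, x j ∈ Set.Icc (a j - m) (a j + s + m)) → χ x = 1) ∧
        (∀ x : EuclideanSpace ℝ (Fin 3), (∃ j, x j ∉ Set.Ioo (a j - m - w) (a j + s + m + w)) →
            χ x = 0 ∧ fderiv ℝ χ x = 0 ∧ fderiv ℝ η x = 0) ∧
        (∀ x, ‖fderiv ℝ χ x‖ ^ 2 + ‖fderiv ℝ η x‖ ^ 2 ≤ C₀ / w ^ 2) := by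
  obtain ⟨D, hD0, hD⟩ := exists_profile
  refine ⟨(π / 2 * (3 * D)) ^ 2 + 1, by positivity, fun a s m w _hs _hm hw => ?_⟩
  choose θ hθc hθ01 hθin hθout hθB using fun j : Fin 3 => hD (a j - m) (a j + s + m) w hw
  obtain ⟨g', hgc, hg, hzero, hgB⟩ :=
    product_profile θ (D / w) (div_nonneg hD0 hw.le) hθc hθ01 hθB
  have hC : (π / 2 * (3 * (D / w))) ^ 2 ≤ ((π / 2 * (3 * D)) ^ 2 + 1) / w ^ 2 := by
    have : (π / 2 * (3 * (D / w))) ^ 2 = (π / 2 * (3 * D)) ^ 2 / w ^ 2 := by ring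
    rw [this]
    exact div_le_div_of_nonneg_right (by linarith) (by positivity)
  have h_in : ∀ x ∈ {x : EuclideanSpace ℝ (Fin 3) | ∀ j, x j ∈ Icc (a j - m) (a j + s + m)},
      θ 0 (x 0) * θ 1 (x 1) * θ 2 (x 2) = 1 := by
    intro x hx
    simp only [mem_setOf_eq] at hx
    simp [hθin 0 _ (hx 0), hθin 1 _ (hx 1), hθin 2 _ (hx 2)]
  have h_out : ∀ x ∈ {x : EuclideanSpace ℝ (Fin 3) | ∃ j, x j ∉ Ioo (a j - m - w) (a j + s + m + w)},
      θ 0 (x 0) * θ 1 (x 1) * θ 2 (x 2) = 0 ∧ g' x = 0 := by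
    rintro x ⟨j, hj⟩
    exact hzero x ⟨j, hθout j _ hj⟩
  exact partition_of_hasFDerivAt _ g' (3 * (D / w)) _ _ _ hgc hg h_in h_out hgB hC

/-! ### Part (ii): counting isolated points in a cube -/

/-- **Part (ii) of the stub**: in a half-open cube of side `s`, at most `(⌈2s/R⌉₊ + 1)³` points of a
finite family are `R`-isolated from the other points of the family in the cube (pigeonhole on sub-cubes
of side `R/2`). [folklore] -/
theorem isolated_card_le (N : ℕ) (a : Fin 3 → ℝ) (s R : ℝ) (_hs : 0 < s) (hR : 0 < R)
    (X : Fin N → EuclideanSpace ℝ (Fin 3)) :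
    ((Finset.univ.filter fun i : Fin N =>
        (∀ j, X i j ∈ Set.Ico (a j) (a j + s)) ∧
          ∀ i' : Fin N, i' ≠ i → (∀ j, X i' j ∈ Set.Ico (a j) (a j + s)) → R ≤ dist (X i) (X i')).card : ℝ) ≤
      ((⌈2 * s / R⌉₊ : ℝ) + 1) ^ 3 := by
  classical
  set K : ℕ := ⌈2 * s / R⌉₊ with hK
  set S := Finset.univ.filter fun i : Fin N => (∀ j, X i j ∈ Set.Ico (a j) (a j + s)) ∧
    ∀ i' : Fin N, i' ≠ i → (∀ j, X i' j ∈ Set.Ico (a j) (a j + s)) → R ≤ dist (X i) (X i') with hS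
  set q : Fin N → (Fin 3 → ℕ) := fun i j => ⌊(X i j - a j) / (R / 2)⌋₊ with hq
  have hmaps : Set.MapsTo q S (Fintype.piFinset fun _ : Fin 3 => Finset.range (K + 1)) := by
    intro i hi
    rw [Finset.mem_coe, hS, Finset.mem_filter] at hi
    rw [Finset.mem_coe, Fintype.mem_piFinset]
    intro j
    rw [Finset.mem_range]
    have hx := hi.2.1 j
    have h0 : 0 ≤ (X i j - a j) / (R / 2) := div_nonneg (by linarith [hx.1]) (by positivity)
    have h1 : (X i j - a j) / (R / 2) < K := by
      calc (X i j - a j) / (R / 2) < s / (R / 2) := by gcongr; linarith [hx.2]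
        _ = 2 * s / R := by ring
        _ ≤ K := Nat.le_ceil _
    exact Nat.lt_succ_of_lt ((Nat.floor_lt h0).2 h1)
  have hinj : Set.InjOn q S := by
    intro i hi i' hi' hqq
    by_contra hne
    rw [Finset.mem_coe, hS, Finset.mem_filter] at hi hi'
    have hfar : R ≤ dist (X i) (X i') := hi.2.2 i' (Ne.symm hne) hi'.2.1
    have hnear : ∀ j, |X i j - X i' j| < R / 2 := by
      intro j
      have hq_j : ⌊(X i j - a j) / (R / 2)⌋₊ = ⌊(X i' j - a j) / (R / 2)⌋₊ := congr_fun hqq j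
      have h0 : 0 ≤ (X i j - a j) / (R / 2) := div_nonneg (by linarith [(hi.2.1 j).1]) (by positivity)
      have h0' : 0 ≤ (X i' j - a j) / (R / 2) :=
        div_nonneg (by linarith [(hi'.2.1 j).1]) (by positivity)
      have key : |(X i j - a j) / (R / 2) - (X i' j - a j) / (R / 2)| < 1 := by
        -- two nonnegative reals with the same natural floor differ by less than `1`
        have h1 := Nat.lt_floor_add_one ((X i j - a j) / (R / 2))
        have h2 := Nat.lt_floor_add_one ((X i' j - a j) / (R / 2))
        have h3 := Nat.floor_le h0
        have h4 := Nat.floor_le h0'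
        have h5 : ((⌊(X i j - a j) / (R / 2)⌋₊ : ℕ) : ℝ) = ((⌊(X i' j - a j) / (R / 2)⌋₊ : ℕ) : ℝ) := by
          exact_mod_cast hq_j
        rw [abs_sub_lt_iff]; constructor <;> linarith
      have : (X i j - a j) / (R / 2) - (X i' j - a j) / (R / 2) = (X i j - X i' j) / (R / 2) := by ring
      rw [this, abs_div, abs_of_pos (by positivity : (0:ℝ) < R / 2), div_lt_one (by positivity)] at key
      exact key
    have hlt : dist (X i) (X i') < R := by
      rw [EuclideanSpace.dist_eq, Real.sqrt_lt' hR]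
      calc ∑ j, dist (X i j) (X i' j) ^ 2 ≤ ∑ _j : Fin 3, (R / 2) ^ 2 :=
            Finset.sum_le_sum fun j _ => by
              rw [Real.dist_eq]; exact pow_le_pow_left₀ (abs_nonneg _) (hnear j).le 2
        _ = 3 * (R / 2) ^ 2 := by simp
        _ < R ^ 2 := by nlinarith
    exact absurd hfar (not_le.2 hlt)
  calc (S.card : ℝ) ≤ ((Fintype.piFinset fun _ : Fin 3 => Finset.range (K + 1)).card : ℝ) := by
        exact_mod_cast Finset.card_le_card_of_injOn q hmaps hinj
    _ = ((K : ℝ) + 1) ^ 3 := by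
        rw [Fintype.card_piFinset_const, Finset.card_range]; push_cast; ring

end CutoffCount

/-- **Stub `stub_cutoffAndCount`** (line `registered` of crux `OneBodyEntropyBound`): (i) a `C¹` one-body
partition `χ² + η² = 1` adapted to a coordinate box with margin `m` and transition width `w`, `χ = 1` on
the closed box, `χ = ∇χ = ∇η = 0` off the `w`-enlarged open box, `‖∇χ‖² + ‖∇η‖² ≤ C₀ / w²` with a
universal constant `C₀`; (ii) at most `(⌈2s/R⌉₊ + 1)³` points of a finite family in a half-open cube of
side `s` are `R`-isolated from the other points of the family in that cube. [folklore] -/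
theorem stub_cutoffAndCount :
    (∃ C₀ : ℝ, 0 < C₀ ∧ ∀ (a : Fin 3 → ℝ) (s m w : ℝ), 0 ≤ s → 0 ≤ m → 0 < w →
      ∃ χ η : EuclideanSpace ℝ (Fin 3) → ℝ,
        ContDiff ℝ 1 χ ∧ ContDiff ℝ 1 η ∧ (∀ x, χ x ^ 2 + η x ^ 2 = 1) ∧
        (∀ x : EuclideanSpace ℝ (Fin 3), (∀ j, x j ∈ Set.Icc (a j - m) (a j + s + m)) → χ x = 1) ∧
        (∀ x : EuclideanSpace ℝ (Fin 3), (∃ j, x j ∉ Set.Ioo (a j - m - w) (a j + s + m + w)) →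
            χ x = 0 ∧ fderiv ℝ χ x = 0 ∧ fderiv ℝ η x = 0) ∧
        (∀ x, ‖fderiv ℝ χ x‖ ^ 2 + ‖fderiv ℝ η x‖ ^ 2 ≤ C₀ / w ^ 2)) ∧
    (∀ (N : ℕ) (a : Fin 3 → ℝ) (s R : ℝ), 0 < s → 0 < R →
      ∀ X : Fin N → EuclideanSpace ℝ (Fin 3),
        ((Finset.univ.filter fun i : Fin N =>
            (∀ j, X i j ∈ Set.Ico (a j) (a j + s)) ∧
              ∀ i' : Fin N, i' ≠ i → (∀ j, X i' j ∈ Set.Ico (a j) (a j + s)) → R ≤ dist (X i) (X i')).card : ℝ) ≤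
          ((⌈2 * s / R⌉₊ : ℝ) + 1) ^ 3) :=
  ⟨CutoffCount.cutoff_exists, CutoffCount.isolated_card_le⟩

end Summit.AtomisticToContinuum.BoseEinsteinCondensation.Cruxes.OneBodyEntropyBound.Birth
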